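import Summits.HodgeConjecture.HodgeConjecture.Theorems.Ring2WeilCoverageWeilGramCMPoint
import Summits.HodgeConjecture.HodgeConjecture.Theorems.Ring2WeilCoverageCyclotomicUnconditional
import Summits.HodgeConjecture.HodgeConjecture.Theorems.Ring2WeilCoverageRealUnitNormHalfSystems
import Summits.HodgeConjecture.HodgeConjecture.Theorems.Ring2WeilCoverageNormTable
import Mathlib.Tactic.ComputeDegree
import HarnessLib

/-!
# Weil-type family coverage — THE COMPONENTS OF THE WEIL-TYPE `ℤ[ζ₃₆]`-SIXFOLDS, I: level lemmas and the principal-type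
# form `(E_ξ, i)`, `i = ζ⁹`: van Geemen Gram determinant `det a = −64 = −8²` in the real frame `1, θ, …, θ⁵` of
# `ℚ(ζ₃₆)⁺` — RIGHT sign for Weil signature `(3,3)`, SPLIT class (the census YES row `(36, ℚ(i))`, row R0 for `ℚ(i)`)

research route conditional on HC_CM; not a corollary; Q11.4-sentence-2 already refuted in dim ≥ 3.

Ring 2, WEIL-TYPE FAMILY-COVERAGE CENSUS (`HOME/WEIL-FAMILY-COVERAGE.md` `## b01`, block b01.41 (C) «COMPONENTS (S-pencil,
exact)» at `g = 6` — among them pub-hsemireg's named target rows **R1 = `(3, ℚ(√−3), 2)`** (type `𝔮₂` at `36`) and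
**R3 = `(3, ℚ(i), 3)`** (type `𝔮₂𝔮₃` at `36`); b01.47 (E) «NOT CLAIMED: the `g = 6` placements»; owner ring2-b01), part
109 of the `Ring2WeilCoverage*` series: the level-`36` companion of parts 98/104 (`K = ℚ(ζ₃₆)`, `g = 6`, `n = 3`,
`ξ = ζ⁵/Φ₃₆′(ζ)`, frame `xᵢ = θ^i`, `θ = ζ + ζ⁻¹`, `i < 6`; independent of part 98).

* §0 level lemmas: `Φ₃₆(ζ) = ζ¹² − ζ⁶ + 1 = 0`, `θζ = ζ² + 1`, `i = ζ⁹` skew with `i² = −1`, `ξ` skew; §0b the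
  evaluation step (part 81).
* §1 the eleven traces `Tr(ξ i θ^m)`, `m ≤ 10`, and the Gram datum: **`a = −(Tr(ξ i θ^{i+j}))`, `det a = −64`** —
  right sign; part 110 (`…Level36Principal`): basis, invariance, census form, SPLIT (row R0 for `ℚ(i)`); parts 111–115:
  `ℚ(√−3)` (NO row), type `𝔮₃` (split), **type `𝔮₂` → R1**, type `(1 + 2√3)` → `(3, ℚ(√−3), 11)`, **type `𝔮₂𝔮₃` → R3**.

HONEST FRAMING as parts 82–108: kernel statements about traces in `ℚ(ζ₃₆)` and the rational Gram matrices of part 82;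
the ROW words read the class `[det a]` by [vG94 Lemma 5.2 (3), (5.4.1)]; nothing about Hodge classes, `W_K`, general
members or HC; `HC_CM` is used nowhere.  No `def`, no named fact, no `sorry`.  Certificates from `work/py/gen6.py` +
`lev36.py` (exact arithmetic in `ℚ[x]/Φ₃₆`), re-verified by `linear_combination`.

References: [cite: vanGeemen1994HodgeAV, Lemma 5.2 (2)–(4), 5.4 and (5.4.1)]; [cite: Shimura1998, §14.3 Prop. 4–5,
pp. 103–104]; [cite: NeukirchANT1999, Ch. III (2.4)]; census b01.41 (C) (seat-derived).
-/

noncomputable section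

open Polynomial NumberField Module
open scoped nonZeroDivisors

namespace Summit.HodgeConjecture.Ring2WeilCoverage.WeilGramLevel36

open Literature.AlgebraicGeometry.VanGeemen1994 (weilField weilNormResidueGroup)
open Literature.AlgebraicGeometry.Motives (CMType normUnitsSubgroup)
open Literature.NumberTheory.ComplexMultiplication
open Summit.HodgeConjecture.Ring2WeilCoverage.TraceGramDeterminant (trace_aeval_zeta_mul_inv)
open Summit.HodgeConjecture.Ring2WeilCoverage.WeilGramCMPoint
open Summit.HodgeConjecture.Ring2WeilCoverage.RealUnitNormHalfSystems (complexConj_eq_inv)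
open Summit.HodgeConjecture.Ring2WeilCoverage.CyclotomicPrincipalObstruction (complexConj_xi)
open Summit.HodgeConjecture.Ring2WeilCoverage.CyclotomicDifferent (isOfType_one_xi_top xi_ne_zero)
open Summit.HodgeConjecture.HodgeConjecture.Ring2.WeilCoverage (mk_neg_eq_split_of_odd mk_neg_ne_split_of_odd
  mem_normUnitsSubgroup_of_sq_add_mul_sq)
open Summit.HodgeConjecture.HodgeConjecture.Ring2.Hypotheses (splitDiscriminantClass)
variable {K : Type} [Field K] [NumberField K] {ζ : K}

/-! ### §0 Level lemmas -/

omit [NumberField K] in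
/-- **`Φ₃₆(ζ) = 0` written out**: `ζ¹² − ζ⁶ + 1 = 0` (`(x¹⁸ − 1)(x⁶ + 1)Φ₃₆(x) = x³⁶ − 1`, `ζ¹⁸ ≠ 1`, `ζ¹² ≠ 1`).
research route conditional on HC_CM; not a corollary; Q11.4-sentence-2 already refuted in dim ≥ 3. [folklore] -/
theorem cyc_thirtySix (hζ : IsPrimitiveRoot ζ 36) : ζ ^ 12 - ζ ^ 6 + 1 = 0 := by
  have h36 : ζ ^ 36 = 1 := hζ.pow_eq_one
  have h18 : ζ ^ 18 - 1 ≠ 0 := sub_ne_zero.mpr (hζ.pow_ne_one_of_pos_of_lt (by norm_num) (by norm_num))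
  have h12 : ζ ^ 12 ≠ 1 := hζ.pow_ne_one_of_pos_of_lt (by norm_num) (by norm_num)
  have h6 : ζ ^ 6 + 1 ≠ 0 := by
    intro h
    apply h12
    linear_combination (ζ ^ 6 - 1) * h
  have h : (ζ ^ 18 - 1) * (ζ ^ 6 + 1) * (ζ ^ 12 - ζ ^ 6 + 1) = 0 := by
    linear_combination h36
  rcases mul_eq_zero.mp h with h' | h'
  · exact absurd h' (mul_ne_zero h18 h6)
  · exact h'

omit [NumberField K] in
/-- `θζ = ζ² + 1` for `θ = ζ + ζ⁻¹`. [folklore] -/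
theorem theta_mul_zeta (hζ : IsPrimitiveRoot ζ 36) : (ζ + ζ⁻¹) * ζ = ζ ^ 2 + 1 := by
  have hζ0 : ζ ≠ 0 := hζ.ne_zero (by norm_num)
  rw [add_mul, inv_mul_cancel₀ hζ0]
  ring

omit [NumberField K] in
/-- `(ζ⁻¹)^a = ζ^b` when `a + b = 36`. [folklore] -/
theorem inv_pow_eq_pow (hζ : IsPrimitiveRoot ζ 36) {a b : ℕ} (hab : a + b = 36) : ζ⁻¹ ^ a = ζ ^ b := by
  rw [inv_pow]
  apply inv_eq_of_mul_eq_one_right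
  rw [← pow_add, hab, hζ.pow_eq_one]

/-- `θ = ζ + ζ⁻¹` is real. [folklore] -/
theorem complexConj_theta [IsCMField K] (hζ : IsPrimitiveRoot ζ 36) :
    IsCMField.complexConj K (ζ + ζ⁻¹) = ζ + ζ⁻¹ := by
  rw [map_add, map_inv₀, complexConj_eq_inv hζ, inv_inv, add_comm]

/-- The frame `xᵢ = θ^i` is real. [folklore] -/
theorem complexConj_thetaFrame [IsCMField K] (hζ : IsPrimitiveRoot ζ 36) {m : ℕ} {x : Fin m → K}
    (hx : ∀ i, x i = (ζ + ζ⁻¹) ^ (i : ℕ)) (i : Fin m) : IsCMField.complexConj K (x i) = x i := by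
  rw [hx i, map_pow, complexConj_theta hζ]

/-- `ξ = ζ⁵/Φ′(ζ)` is skew (part 7, `g − 1 = 5`). [folklore] -/
theorem complexConj_xi_thirtySix [IsCMField K] (hζ : IsPrimitiveRoot ζ 36) :
    IsCMField.complexConj K (ζ ^ 5 * (aeval ζ (derivative (cyclotomic 36 ℚ)))⁻¹) =
      -(ζ ^ 5 * (aeval ζ (derivative (cyclotomic 36 ℚ)))⁻¹) :=
  complexConj_xi hζ (k := 5) (by decide)

omit [NumberField K] in
/-- **`(ζ⁹)² = −1`**: `s = √−1 = ζ⁹ = i` generates `K_d = ℚ(√−1) ⊂ ℚ(ζ_36)`. [folklore] -/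
theorem sq_sqrtNegOne (hζ : IsPrimitiveRoot ζ 36) : (ζ ^ 9) ^ 2 = -1 := by
  linear_combination (1 + ζ^6) * cyc_thirtySix hζ

/-- **`s = √−1 = ζ⁹ = i` is skew** (`s^ρ = −s`). [folklore] -/
theorem complexConj_sqrtNegOne [IsCMField K] (hζ : IsPrimitiveRoot ζ 36) :
    IsCMField.complexConj K (ζ ^ 9) = -(ζ ^ 9) := by
  simp only [map_pow, complexConj_eq_inv hζ]
  rw [inv_pow_eq_pow hζ (show 9 + 27 = 36 by norm_num)]
  linear_combination (ζ^9 + ζ^15) * cyc_thirtySix hζ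


/-! ### §0b The evaluation step: `Tr(y·θ^m)` from a certificate `y(ζ² + 1)^m = R(ζ)Φ′(ζ)⁻¹ζ^m` (part 81) -/

/-- `Tr_{K/ℚ}(y) = coeff₁₁(R)` if `y = R(ζ)/Φ′(ζ)` with `deg R ≤ 11` (part 81 `trace_aeval_zeta_mul_inv`). research route conditional on HC_CM; not a corollary; Q11.4-sentence-2 already refuted in dim ≥ 3. [folklore] -/
theorem trace_of_key₀ [IsCyclotomicExtension {36} ℚ K] (hζ : IsPrimitiveRoot ζ 36) {y : K} (R : ℚ[X])
    (hR : R.natDegree ≤ 11) (hkey : y = aeval ζ R * (aeval ζ (derivative (cyclotomic 36 ℚ)))⁻¹) :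
    Algebra.trace ℚ K y = R.coeff 11 := by
  have hφ : Nat.totient 36 = 12 := by decide
  rw [hkey, trace_aeval_zeta_mul_inv hζ R (by rw [hφ]; omega), hφ]

/-- `Tr_{K/ℚ}(y·θ) = coeff₁₁(R)` if `y(ζ² + 1) = R(ζ)Φ′(ζ)⁻¹·ζ` (`θζ = ζ² + 1`). research route conditional on HC_CM; not a corollary; Q11.4-sentence-2 already refuted in dim ≥ 3. [folklore] -/
theorem trace_of_key₁ [IsCyclotomicExtension {36} ℚ K] (hζ : IsPrimitiveRoot ζ 36) {y : K} (R : ℚ[X])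
    (hR : R.natDegree ≤ 11) (hkey : y * (ζ ^ 2 + 1) = aeval ζ R * (aeval ζ (derivative (cyclotomic 36 ℚ)))⁻¹ * ζ) :
    Algebra.trace ℚ K (y * (ζ + ζ⁻¹)) = R.coeff 11 := by
  have hζ0 : ζ ≠ 0 := hζ.ne_zero (by norm_num)
  refine trace_of_key₀ hζ R hR (mul_right_cancel₀ hζ0 ?_)
  rw [mul_assoc, theta_mul_zeta hζ, hkey]

/-- `Tr_{K/ℚ}(y·θ^m) = coeff₁₁(R)` if `y(ζ² + 1)^m = R(ζ)Φ′(ζ)⁻¹·ζ^m` (`θ^m ζ^m = (ζ² + 1)^m`). research route conditional on HC_CM; not a corollary; Q11.4-sentence-2 already refuted in dim ≥ 3. [folklore] -/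
theorem trace_of_key [IsCyclotomicExtension {36} ℚ K] (hζ : IsPrimitiveRoot ζ 36) {y : K} {m : ℕ} (R : ℚ[X])
    (hR : R.natDegree ≤ 11) (hkey : y * (ζ ^ 2 + 1) ^ m = aeval ζ R * (aeval ζ (derivative (cyclotomic 36 ℚ)))⁻¹ * ζ ^ m) :
    Algebra.trace ℚ K (y * (ζ + ζ⁻¹) ^ m) = R.coeff 11 := by
  have hζ0 : ζ ≠ 0 := hζ.ne_zero (by norm_num)
  refine trace_of_key₀ hζ R hR (mul_right_cancel₀ (pow_ne_zero m hζ0) ?_)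
  rw [mul_assoc, ← mul_pow, theta_mul_zeta hζ, hkey]

/-! ### §1 The principal-type form `(E_ξ, i)`: eleven traces, the `6 × 6` Hankel matrix, `det a = −64` -/

/-- `Tr(ζ′sθ^0) = 0` for `ζ′ = ξ = ζ⁵/Φ₃₆′(ζ)`, `s = √−1 = ζ⁹ = i`, `θ = ζ + ζ⁻¹` (Euler evaluation). research route conditional on HC_CM; not a corollary; Q11.4-sentence-2 already refuted in dim ≥ 3. [folklore] -/
theorem trace_xi_sqrtNegOne_zero [IsCyclotomicExtension {36} ℚ K] (hζ : IsPrimitiveRoot ζ 36) :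
    Algebra.trace ℚ K ((ζ ^ 5 * (aeval ζ (derivative (cyclotomic 36 ℚ)))⁻¹) * (ζ ^ 9)) = 0 := by
  have hΦ := cyc_thirtySix hζ
  rw [trace_of_key₀ hζ (C (0 : ℚ) + C (0 : ℚ) * X + C (-1 : ℚ) * X ^ 2 + C (0 : ℚ) * X ^ 3 + C (0 : ℚ) * X ^ 4 + C (0 : ℚ) * X ^ 5 +
      C (0 : ℚ) * X ^ 6 + C (0 : ℚ) * X ^ 7 + C (1 : ℚ) * X ^ 8 + C (0 : ℚ) * X ^ 9 + C (0 : ℚ) * X ^ 10 +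
      C (0 : ℚ) * X ^ 11) (by compute_degree) (by
    simp only [map_add, map_mul, map_pow, aeval_C, aeval_X, eq_ratCast]
    push_cast
    linear_combination ((aeval ζ (derivative (cyclotomic 36 ℚ)))⁻¹ * (ζ^2)) * hΦ)]
  norm_num [coeff_X_pow, coeff_X, coeff_C, coeff_one]

/-- `Tr(ζ′sθ^1) = 0` for `ζ′ = ξ = ζ⁵/Φ₃₆′(ζ)`, `s = √−1 = ζ⁹ = i`, `θ = ζ + ζ⁻¹` (Euler evaluation). research route conditional on HC_CM; not a corollary; Q11.4-sentence-2 already refuted in dim ≥ 3. [folklore] -/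
theorem trace_xi_sqrtNegOne_one [IsCyclotomicExtension {36} ℚ K] (hζ : IsPrimitiveRoot ζ 36) :
    Algebra.trace ℚ K ((ζ ^ 5 * (aeval ζ (derivative (cyclotomic 36 ℚ)))⁻¹) * (ζ ^ 9) * (ζ + ζ⁻¹)) = 0 := by
  have hΦ := cyc_thirtySix hζ
  rw [trace_of_key₁ hζ (C (0 : ℚ) + C (-1 : ℚ) * X + C (0 : ℚ) * X ^ 2 + C (-1 : ℚ) * X ^ 3 + C (0 : ℚ) * X ^ 4 +
      C (0 : ℚ) * X ^ 5 + C (0 : ℚ) * X ^ 6 + C (1 : ℚ) * X ^ 7 + C (0 : ℚ) * X ^ 8 + C (1 : ℚ) * X ^ 9 +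
      C (0 : ℚ) * X ^ 10 + C (0 : ℚ) * X ^ 11) (by compute_degree) (by
    simp only [map_add, map_mul, map_pow, aeval_C, aeval_X, eq_ratCast]
    push_cast
    linear_combination ((aeval ζ (derivative (cyclotomic 36 ℚ)))⁻¹ * (ζ^2 + ζ^4)) * hΦ)]
  norm_num [coeff_X_pow, coeff_X, coeff_C, coeff_one]

/-- `Tr(ζ′sθ^2) = 0` for `ζ′ = ξ = ζ⁵/Φ₃₆′(ζ)`, `s = √−1 = ζ⁹ = i`, `θ = ζ + ζ⁻¹` (Euler evaluation). research route conditional on HC_CM; not a corollary; Q11.4-sentence-2 already refuted in dim ≥ 3. [folklore] -/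
theorem trace_xi_sqrtNegOne_two [IsCyclotomicExtension {36} ℚ K] (hζ : IsPrimitiveRoot ζ 36) :
    Algebra.trace ℚ K ((ζ ^ 5 * (aeval ζ (derivative (cyclotomic 36 ℚ)))⁻¹) * (ζ ^ 9) * (ζ + ζ⁻¹) ^ 2) = 0 := by
  have hΦ := cyc_thirtySix hζ
  rw [trace_of_key hζ (C (-1 : ℚ) + C (0 : ℚ) * X + C (-2 : ℚ) * X ^ 2 + C (0 : ℚ) * X ^ 3 + C (-1 : ℚ) * X ^ 4 +
      C (0 : ℚ) * X ^ 5 + C (1 : ℚ) * X ^ 6 + C (0 : ℚ) * X ^ 7 + C (2 : ℚ) * X ^ 8 + C (0 : ℚ) * X ^ 9 +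
      C (1 : ℚ) * X ^ 10 + C (0 : ℚ) * X ^ 11) (by compute_degree) (by
    simp only [map_add, map_mul, map_pow, aeval_C, aeval_X, eq_ratCast]
    push_cast
    linear_combination ((aeval ζ (derivative (cyclotomic 36 ℚ)))⁻¹ * (ζ^2 + 2 * ζ^4 + ζ^6)) * hΦ)]
  norm_num [coeff_X_pow, coeff_X, coeff_C, coeff_one]

/-- `Tr(ζ′sθ^3) = 2` for `ζ′ = ξ = ζ⁵/Φ₃₆′(ζ)`, `s = √−1 = ζ⁹ = i`, `θ = ζ + ζ⁻¹` (Euler evaluation). research route conditional on HC_CM; not a corollary; Q11.4-sentence-2 already refuted in dim ≥ 3. [folklore] -/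
theorem trace_xi_sqrtNegOne_three [IsCyclotomicExtension {36} ℚ K] (hζ : IsPrimitiveRoot ζ 36) :
    Algebra.trace ℚ K ((ζ ^ 5 * (aeval ζ (derivative (cyclotomic 36 ℚ)))⁻¹) * (ζ ^ 9) * (ζ + ζ⁻¹) ^ 3) = 2 := by
  have hΦ := cyc_thirtySix hζ
  rw [trace_of_key hζ (C (0 : ℚ) + C (-3 : ℚ) * X + C (0 : ℚ) * X ^ 2 + C (-3 : ℚ) * X ^ 3 + C (0 : ℚ) * X ^ 4 +
      C (-1 : ℚ) * X ^ 5 + C (0 : ℚ) * X ^ 6 + C (3 : ℚ) * X ^ 7 + C (0 : ℚ) * X ^ 8 + C (3 : ℚ) * X ^ 9 +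
      C (0 : ℚ) * X ^ 10 + C (2 : ℚ) * X ^ 11) (by compute_degree) (by
    simp only [map_add, map_mul, map_pow, aeval_C, aeval_X, eq_ratCast]
    push_cast
    linear_combination ((aeval ζ (derivative (cyclotomic 36 ℚ)))⁻¹ * (3 * ζ^4 + 3 * ζ^6 + ζ^8)) * hΦ)]
  norm_num [coeff_X_pow, coeff_X, coeff_C, coeff_one]

/-- `Tr(ζ′sθ^4) = 0` for `ζ′ = ξ = ζ⁵/Φ₃₆′(ζ)`, `s = √−1 = ζ⁹ = i`, `θ = ζ + ζ⁻¹` (Euler evaluation). research route conditional on HC_CM; not a corollary; Q11.4-sentence-2 already refuted in dim ≥ 3. [folklore] -/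
theorem trace_xi_sqrtNegOne_four [IsCyclotomicExtension {36} ℚ K] (hζ : IsPrimitiveRoot ζ 36) :
    Algebra.trace ℚ K ((ζ ^ 5 * (aeval ζ (derivative (cyclotomic 36 ℚ)))⁻¹) * (ζ ^ 9) * (ζ + ζ⁻¹) ^ 4) = 0 := by
  have hΦ := cyc_thirtySix hζ
  rw [trace_of_key hζ (C (-5 : ℚ) + C (0 : ℚ) * X + C (-6 : ℚ) * X ^ 2 + C (0 : ℚ) * X ^ 3 + C (-4 : ℚ) * X ^ 4 +
      C (0 : ℚ) * X ^ 5 + C (4 : ℚ) * X ^ 6 + C (0 : ℚ) * X ^ 7 + C (6 : ℚ) * X ^ 8 + C (0 : ℚ) * X ^ 9 +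
      C (5 : ℚ) * X ^ 10 + C (0 : ℚ) * X ^ 11) (by compute_degree) (by
    simp only [map_add, map_mul, map_pow, aeval_C, aeval_X, eq_ratCast]
    push_cast
    linear_combination ((aeval ζ (derivative (cyclotomic 36 ℚ)))⁻¹ * (5 * ζ^4 + 6 * ζ^6 + 4 * ζ^8 + ζ^10)) * hΦ)]
  norm_num [coeff_X_pow, coeff_X, coeff_C, coeff_one]

/-- `Tr(ζ′sθ^5) = 10` for `ζ′ = ξ = ζ⁵/Φ₃₆′(ζ)`, `s = √−1 = ζ⁹ = i`, `θ = ζ + ζ⁻¹` (Euler evaluation). research route conditional on HC_CM; not a corollary; Q11.4-sentence-2 already refuted in dim ≥ 3. [folklore] -/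
theorem trace_xi_sqrtNegOne_five [IsCyclotomicExtension {36} ℚ K] (hζ : IsPrimitiveRoot ζ 36) :
    Algebra.trace ℚ K ((ζ ^ 5 * (aeval ζ (derivative (cyclotomic 36 ℚ)))⁻¹) * (ζ ^ 9) * (ζ + ζ⁻¹) ^ 5) = 10 := by
  have hΦ := cyc_thirtySix hζ
  rw [trace_of_key hζ (C (0 : ℚ) + C (-11 : ℚ) * X + C (0 : ℚ) * X ^ 2 + C (-10 : ℚ) * X ^ 3 + C (0 : ℚ) * X ^ 4 +
      C (-5 : ℚ) * X ^ 5 + C (0 : ℚ) * X ^ 6 + C (10 : ℚ) * X ^ 7 + C (0 : ℚ) * X ^ 8 + C (11 : ℚ) * X ^ 9 +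
      C (0 : ℚ) * X ^ 10 + C (10 : ℚ) * X ^ 11) (by compute_degree) (by
    simp only [map_add, map_mul, map_pow, aeval_C, aeval_X, eq_ratCast]
    push_cast
    linear_combination ((aeval ζ (derivative (cyclotomic 36 ℚ)))⁻¹ * (11 * ζ^6 + 10 * ζ^8 + 5 * ζ^10 + ζ^12)) * hΦ)]
  norm_num [coeff_X_pow, coeff_X, coeff_C, coeff_one]

/-- `Tr(ζ′sθ^6) = 0` for `ζ′ = ξ = ζ⁵/Φ₃₆′(ζ)`, `s = √−1 = ζ⁹ = i`, `θ = ζ + ζ⁻¹` (Euler evaluation). research route conditional on HC_CM; not a corollary; Q11.4-sentence-2 already refuted in dim ≥ 3. [folklore] -/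
theorem trace_xi_sqrtNegOne_six [IsCyclotomicExtension {36} ℚ K] (hζ : IsPrimitiveRoot ζ 36) :
    Algebra.trace ℚ K ((ζ ^ 5 * (aeval ζ (derivative (cyclotomic 36 ℚ)))⁻¹) * (ζ ^ 9) * (ζ + ζ⁻¹) ^ 6) = 0 := by
  have hΦ := cyc_thirtySix hζ
  rw [trace_of_key hζ (C (-21 : ℚ) + C (0 : ℚ) * X + C (-21 : ℚ) * X ^ 2 + C (0 : ℚ) * X ^ 3 + C (-15 : ℚ) * X ^ 4 +
      C (0 : ℚ) * X ^ 5 + C (15 : ℚ) * X ^ 6 + C (0 : ℚ) * X ^ 7 + C (21 : ℚ) * X ^ 8 + C (0 : ℚ) * X ^ 9 +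
      C (21 : ℚ) * X ^ 10 + C (0 : ℚ) * X ^ 11) (by compute_degree) (by
    simp only [map_add, map_mul, map_pow, aeval_C, aeval_X, eq_ratCast]
    push_cast
    linear_combination ((aeval ζ (derivative (cyclotomic 36 ℚ)))⁻¹ * (21 * ζ^6 + 21 * ζ^8 + 15 * ζ^10 + 6 * ζ^12 + ζ^14)) * hΦ)]
  norm_num [coeff_X_pow, coeff_X, coeff_C, coeff_one]

/-- `Tr(ζ′sθ^7) = 42` for `ζ′ = ξ = ζ⁵/Φ₃₆′(ζ)`, `s = √−1 = ζ⁹ = i`, `θ = ζ + ζ⁻¹` (Euler evaluation). research route conditional on HC_CM; not a corollary; Q11.4-sentence-2 already refuted in dim ≥ 3. [folklore] -/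
theorem trace_xi_sqrtNegOne_seven [IsCyclotomicExtension {36} ℚ K] (hζ : IsPrimitiveRoot ζ 36) :
    Algebra.trace ℚ K ((ζ ^ 5 * (aeval ζ (derivative (cyclotomic 36 ℚ)))⁻¹) * (ζ ^ 9) * (ζ + ζ⁻¹) ^ 7) = 42 := by
  have hΦ := cyc_thirtySix hζ
  rw [trace_of_key hζ (C (0 : ℚ) + C (-42 : ℚ) * X + C (0 : ℚ) * X ^ 2 + C (-36 : ℚ) * X ^ 3 + C (0 : ℚ) * X ^ 4 +
      C (-21 : ℚ) * X ^ 5 + C (0 : ℚ) * X ^ 6 + C (36 : ℚ) * X ^ 7 + C (0 : ℚ) * X ^ 8 + C (42 : ℚ) * X ^ 9 +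
      C (0 : ℚ) * X ^ 10 + C (42 : ℚ) * X ^ 11) (by compute_degree) (by
    simp only [map_add, map_mul, map_pow, aeval_C, aeval_X, eq_ratCast]
    push_cast
    linear_combination ((aeval ζ (derivative (cyclotomic 36 ℚ)))⁻¹ * (42 * ζ^8 + 36 * ζ^10 + 21 * ζ^12 + 7 * ζ^14 + ζ^16)) * hΦ)]
  norm_num [coeff_X_pow, coeff_X, coeff_C, coeff_one]

/-- `Tr(ζ′sθ^8) = 0` for `ζ′ = ξ = ζ⁵/Φ₃₆′(ζ)`, `s = √−1 = ζ⁹ = i`, `θ = ζ + ζ⁻¹` (Euler evaluation). research route conditional on HC_CM; not a corollary; Q11.4-sentence-2 already refuted in dim ≥ 3. [folklore] -/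
theorem trace_xi_sqrtNegOne_eight [IsCyclotomicExtension {36} ℚ K] (hζ : IsPrimitiveRoot ζ 36) :
    Algebra.trace ℚ K ((ζ ^ 5 * (aeval ζ (derivative (cyclotomic 36 ℚ)))⁻¹) * (ζ ^ 9) * (ζ + ζ⁻¹) ^ 8) = 0 := by
  have hΦ := cyc_thirtySix hζ
  rw [trace_of_key hζ (C (-84 : ℚ) + C (0 : ℚ) * X + C (-78 : ℚ) * X ^ 2 + C (0 : ℚ) * X ^ 3 + C (-57 : ℚ) * X ^ 4 +
      C (0 : ℚ) * X ^ 5 + C (57 : ℚ) * X ^ 6 + C (0 : ℚ) * X ^ 7 + C (78 : ℚ) * X ^ 8 + C (0 : ℚ) * X ^ 9 +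
      C (84 : ℚ) * X ^ 10 + C (0 : ℚ) * X ^ 11) (by compute_degree) (by
    simp only [map_add, map_mul, map_pow, aeval_C, aeval_X, eq_ratCast]
    push_cast
    linear_combination ((aeval ζ (derivative (cyclotomic 36 ℚ)))⁻¹ * (84 * ζ^8 + 78 * ζ^10 + 57 * ζ^12 + 28 * ζ^14 + 8 * ζ^16 + ζ^18)) * hΦ)]
  norm_num [coeff_X_pow, coeff_X, coeff_C, coeff_one]

/-- `Tr(ζ′sθ^9) = 168` for `ζ′ = ξ = ζ⁵/Φ₃₆′(ζ)`, `s = √−1 = ζ⁹ = i`, `θ = ζ + ζ⁻¹` (Euler evaluation). research route conditional on HC_CM; not a corollary; Q11.4-sentence-2 already refuted in dim ≥ 3. [folklore] -/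
theorem trace_xi_sqrtNegOne_nine [IsCyclotomicExtension {36} ℚ K] (hζ : IsPrimitiveRoot ζ 36) :
    Algebra.trace ℚ K ((ζ ^ 5 * (aeval ζ (derivative (cyclotomic 36 ℚ)))⁻¹) * (ζ ^ 9) * (ζ + ζ⁻¹) ^ 9) = 168 := by
  have hΦ := cyc_thirtySix hζ
  rw [trace_of_key hζ (C (0 : ℚ) + C (-162 : ℚ) * X + C (0 : ℚ) * X ^ 2 + C (-135 : ℚ) * X ^ 3 + C (0 : ℚ) * X ^ 4 +
      C (-84 : ℚ) * X ^ 5 + C (0 : ℚ) * X ^ 6 + C (135 : ℚ) * X ^ 7 + C (0 : ℚ) * X ^ 8 + C (162 : ℚ) * X ^ 9 +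
      C (0 : ℚ) * X ^ 10 + C (168 : ℚ) * X ^ 11) (by compute_degree) (by
    simp only [map_add, map_mul, map_pow, aeval_C, aeval_X, eq_ratCast]
    push_cast
    linear_combination ((aeval ζ (derivative (cyclotomic 36 ℚ)))⁻¹ * (162 * ζ^10 + 135 * ζ^12 + 85 * ζ^14 + 36 * ζ^16 + 9 * ζ^18 + ζ^20)) * hΦ)]
  norm_num [coeff_X_pow, coeff_X, coeff_C, coeff_one]

/-- `Tr(ζ′sθ^10) = 0` for `ζ′ = ξ = ζ⁵/Φ₃₆′(ζ)`, `s = √−1 = ζ⁹ = i`, `θ = ζ + ζ⁻¹` (Euler evaluation). research route conditional on HC_CM; not a corollary; Q11.4-sentence-2 already refuted in dim ≥ 3. [folklore] -/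
theorem trace_xi_sqrtNegOne_ten [IsCyclotomicExtension {36} ℚ K] (hζ : IsPrimitiveRoot ζ 36) :
    Algebra.trace ℚ K ((ζ ^ 5 * (aeval ζ (derivative (cyclotomic 36 ℚ)))⁻¹) * (ζ ^ 9) * (ζ + ζ⁻¹) ^ 10) = 0 := by
  have hΦ := cyc_thirtySix hζ
  rw [trace_of_key hζ (C (-330 : ℚ) + C (0 : ℚ) * X + C (-297 : ℚ) * X ^ 2 + C (0 : ℚ) * X ^ 3 + C (-219 : ℚ) * X ^ 4 +
      C (0 : ℚ) * X ^ 5 + C (219 : ℚ) * X ^ 6 + C (0 : ℚ) * X ^ 7 + C (297 : ℚ) * X ^ 8 + C (0 : ℚ) * X ^ 9 +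
      C (330 : ℚ) * X ^ 10 + C (0 : ℚ) * X ^ 11) (by compute_degree) (by
    simp only [map_add, map_mul, map_pow, aeval_C, aeval_X, eq_ratCast]
    push_cast
    linear_combination ((aeval ζ (derivative (cyclotomic 36 ℚ)))⁻¹ * (330 * ζ^10 + 297 * ζ^12 + 220 * ζ^14 + 121 * ζ^16 + 45 * ζ^18 +
        10 * ζ^20 + ζ^22)) * hΦ)]
  norm_num [coeff_X_pow, coeff_X, coeff_C, coeff_one]

/-- **The Gram datum `a` of `(E_ζ′, s)` in the real frame `θ^i` (`i < 6`)** for `ζ′ = ξ = ζ⁵/Φ₃₆′(ζ)` (principal type (1)),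
`s = √−1 = ζ⁹ = i`: the integer Hankel matrix `(−Tr(ζ′sθ^{i+j}))ᵢⱼ` (and `b = 0`, part 82 `hb_eq_zero`).
research route conditional on HC_CM; not a corollary; Q11.4-sentence-2 already refuted in dim ≥ 3. [cite: vanGeemen1994HodgeAV, Lemma 5.2 (2)–(3)] -/
theorem realPart_xi_sqrtNegOne [IsCyclotomicExtension {36} ℚ K] [IsCMField K] (hζ : IsPrimitiveRoot ζ 36)
    {x : Fin 6 → K} (hx : ∀ i, x i = (ζ + ζ⁻¹) ^ (i : ℕ)) {a : Matrix (Fin 6) (Fin 6) ℚ}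
    (ha : ∀ i j, a i j = Algebra.trace ℚ K ((ζ ^ 5 * (aeval ζ (derivative (cyclotomic 36 ℚ)))⁻¹) * x i * IsCMField.complexConj K ((ζ ^ 9) * x j))) :
    a = !![0, 0, 0, -2, 0, -10; 0, 0, -2, 0, -10, 0; 0, -2, 0, -10, 0, -42; -2, 0, -10, 0, -42, 0; 0, -10, 0, -42, 0, -168; -10, 0, -42, 0, -168, 0] := by
  rw [ha_eq (complexConj_sqrtNegOne hζ) (complexConj_thetaFrame hζ hx) ha]
  ext i j
  simp only [Matrix.of_apply, hx, ← pow_add]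
  fin_cases i <;> fin_cases j <;> simp [trace_xi_sqrtNegOne_zero hζ, trace_xi_sqrtNegOne_one hζ, trace_xi_sqrtNegOne_two hζ, trace_xi_sqrtNegOne_three hζ, trace_xi_sqrtNegOne_four hζ, trace_xi_sqrtNegOne_five hζ,
    trace_xi_sqrtNegOne_six hζ, trace_xi_sqrtNegOne_seven hζ, trace_xi_sqrtNegOne_eight hζ, trace_xi_sqrtNegOne_nine hζ, trace_xi_sqrtNegOne_ten hζ]

/-- **`det a = -64`** for `ζ′ = ξ = ζ⁵/Φ₃₆′(ζ)`, `s = √−1 = ζ⁹ = i` (frame `θ^i`, `i < 6`). research route conditional on HC_CM; not a corollary; Q11.4-sentence-2 already refuted in dim ≥ 3. [cite: vanGeemen1994HodgeAV, Lemma 5.2 (3)] -/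
theorem det_realPart_xi_sqrtNegOne [IsCyclotomicExtension {36} ℚ K] [IsCMField K] (hζ : IsPrimitiveRoot ζ 36)
    {x : Fin 6 → K} (hx : ∀ i, x i = (ζ + ζ⁻¹) ^ (i : ℕ)) {a : Matrix (Fin 6) (Fin 6) ℚ}
    (ha : ∀ i j, a i j = Algebra.trace ℚ K ((ζ ^ 5 * (aeval ζ (derivative (cyclotomic 36 ℚ)))⁻¹) * x i * IsCMField.complexConj K ((ζ ^ 9) * x j))) :
    a.det = -64 := by
  rw [realPart_xi_sqrtNegOne hζ hx ha]
  simp [Matrix.det_succ_row_zero, Fin.sum_univ_succ, Fin.succAbove, Matrix.submatrix]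
  norm_num

end Summit.HodgeConjecture.Ring2WeilCoverage.WeilGramLevel36

end
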